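import Mathlib

/-!
# Route RisoStrata — crux `RisoGlobalisation`, line SketchIdeator1: uniform-degree generation

Leaf `stub_uniformGeneration` of the skeleton of `RisoGlobalisation`
(item stmt-ResolutionOfSingularities-18547).

Setting: `h ∈ (Kˣ)^{N+1}` are homogeneous coordinates of the generic point of a projective
variety over `k` with function field `K`; its standard affine charts have coordinate rings
`C_β := k[h_i/h_β] = Algebra.adjoin k (range fun i => h i * (h β)⁻¹) ⊆ K`.  A family of nonzero
ideals `I_β ⊆ C_β` satisfying the pairwise sheaf condition (`hSC`: every `c ∈ I_β` becomes an
element of `I_β'` after multiplication by a power of `h_β/h_β'`) is generated on EVERY chart by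
the dehomogenisations `G_l / h_β^E` of ONE finite family of nonzero "forms" `G_l ∈ K` of a
common degree `E` (elementary version of "`𝒥(E)` is generated by global sections").

Proof: each `C_β` is Noetherian (finitely generated `k`-algebra), so `I_β` is spanned by a
nonempty finite family of nonzero elements `c_{β,j}`.  By `hSC`, `c_{β,j} (h_β/h_β')ⁿ ∈ I_β'`
for some `n = n(β,j,β')`, and then for every larger exponent since `h_β/h_β' ∈ C_β'`; let `E`
dominate all these exponents and put `G_{(β,j)} := c_{β,j} h_β^E` (the finite index set is
flattened to `Fin (M+1)`).  Then `G_{(β,j)}/h_{β'}^E = c_{β,j} (h_β/h_β')^E ∈ I_β'`, so the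
span is contained in `I_β'`, and it contains the generators `c_{β',j} = G_{(β',j)}/h_{β'}^E`.
-/

-- single-problem summit: the doubled namespace component `ResolutionOfSingularities` is forced
set_option linter.dupNamespace false

namespace Summit.ResolutionOfSingularities.ResolutionOfSingularities.Theorems

/-- In a Noetherian ring, a nonzero ideal is spanned by a nonempty finite family of nonzero
elements. -/
theorem uniformGeneration_exists_generators {R : Type*} [CommRing R] [IsNoetherianRing R]
    (I : Ideal R) (hI : I ≠ ⊥) :
    ∃ (n : ℕ) (c : Fin (n + 1) → R), (∀ i, c i ≠ 0) ∧ Ideal.span (Set.range c) = I := by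
  classical
  obtain ⟨S, hS⟩ := IsNoetherian.noetherian I
  have hS' : Ideal.span (S : Set R) = I := hS
  set T := S.erase 0
  have hTspan : Ideal.span (T : Set R) = I := by
    apply le_antisymm
    · rw [← hS']
      exact Ideal.span_mono (Finset.coe_subset.2 (Finset.erase_subset _ _))
    · rw [← hS', Ideal.span_le]
      intro x hx
      by_cases hx0 : x = 0
      · rw [hx0]
        exact zero_mem _
      · exact Ideal.subset_span (Finset.mem_erase.2 ⟨hx0, hx⟩)
  have hTne : T.Nonempty := by
    rw [Finset.nonempty_iff_ne_empty]
    intro hT0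
    apply hI
    rw [← hTspan, hT0, Finset.coe_empty, Ideal.span_empty]
  obtain ⟨n, hn⟩ : ∃ n, T.card = n + 1 :=
    Nat.exists_eq_succ_of_ne_zero (Finset.card_ne_zero.2 hTne)
  refine ⟨n, fun i => ((T.equivFinOfCardEq hn).symm i : R), fun i => ?_, ?_⟩
  · exact (Finset.mem_erase.1 ((T.equivFinOfCardEq hn).symm i).2).1
  · rw [← hTspan]
    congr 1
    ext x
    constructor
    · rintro ⟨i, rfl⟩
      exact ((T.equivFinOfCardEq hn).symm i).2
    · intro hx
      exact ⟨T.equivFinOfCardEq hn ⟨x, hx⟩, by simp⟩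

/-- A subalgebra of a field generated over a field by finitely many elements is a Noetherian
ring. -/
theorem uniformGeneration_isNoetherianRing (k : Type*) {K : Type*} [Field k] [Field K]
    [Algebra k K] {n : ℕ} (f : Fin n → K) :
    IsNoetherianRing ↥(Algebra.adjoin k (Set.range f)) :=
  isNoetherianRing_of_fg (Subalgebra.fg_def.2 ⟨Set.range f, Set.finite_range f, rfl⟩)

variable {k K : Type} [Field k] [Field K] [Algebra k K]

/-- **Uniform-degree generation** (the ideal sheaf `𝒥` twisted high enough is generated by its
global sections, elementary form): a family of nonzero ideals `I_β ⊆ k[hᵢ/h_β]` on the standard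
charts of the projective model of `h`, compatible under the pairwise sheaf condition `hSC`, is
generated on every chart by the dehomogenisations `G_l/h_β^E` of one finite family of nonzero
elements `G_l ∈ K` and one exponent `E`. -/
theorem stub_uniformGeneration {N : ℕ} (h : Fin (N + 1) → K) (hh : ∀ i, h i ≠ 0)
    (I : ∀ β : Fin (N + 1), Ideal ↥(Algebra.adjoin k (Set.range fun i => h i * (h β)⁻¹)))
    (hI : ∀ β, I β ≠ ⊥)
    (hSC : ∀ (β β' : Fin (N + 1)) (c : ↥(Algebra.adjoin k (Set.range fun i => h i * (h β)⁻¹))),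
      c ∈ I β → ∃ (n : ℕ) (a : ↥(Algebra.adjoin k (Set.range fun i => h i * (h β')⁻¹))),
        a ∈ I β' ∧ (a : K) = (c : K) * (h β * (h β')⁻¹) ^ n) :
    ∃ (E M : ℕ) (G : Fin (M + 1) → K) (hG : ∀ β l,
        G l * (h β ^ E)⁻¹ ∈ Algebra.adjoin k (Set.range fun i => h i * (h β)⁻¹)),
      (∀ l, G l ≠ 0) ∧
      ∀ β, Ideal.span (Set.range fun l =>
        (⟨G l * (h β ^ E)⁻¹, hG β l⟩ : ↥(Algebra.adjoin k (Set.range fun i => h i * (h β)⁻¹)))) =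
          I β := by
  classical
  haveI hNoeth : ∀ β : Fin (N + 1),
      IsNoetherianRing ↥(Algebra.adjoin k (Set.range fun i => h i * (h β)⁻¹)) :=
    fun β => uniformGeneration_isNoetherianRing k _
  -- nonzero generators `c β j`, `j : Fin (n β + 1)`, of `I β`
  choose n c hc0 hcspan using fun β => uniformGeneration_exists_generators (I β) (hI β)
  have hcI : ∀ β j, c β j ∈ I β := fun β j => hcspan β ▸ Ideal.subset_span ⟨j, rfl⟩
  -- exponents `m β j β'` and elements `a β j β' ∈ I β'` from the sheaf condition
  choose m a haI hak using
    fun (β : Fin (N + 1)) (j : Fin (n β + 1)) (β' : Fin (N + 1)) => hSC β β' (c β j) (hcI β j)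
  -- one exponent dominating all `m β j β'`
  obtain ⟨E, hE⟩ := Finite.exists_le
    (fun p : (Σ β : Fin (N + 1), Fin (n β + 1)) × Fin (N + 1) => m p.1.1 p.1.2 p.2)
  have hmE : ∀ β j β', m β j β' ≤ E := fun β j β' => hE (⟨β, j⟩, β')
  -- the quotients `h β / h β'` lie in the chart ring of `β'`
  have hq : ∀ β β', h β * (h β')⁻¹ ∈ Algebra.adjoin k (Set.range fun i => h i * (h β')⁻¹) :=
    fun β β' => Algebra.subset_adjoin ⟨β, rfl⟩
  -- key identity: `c h_β^E / h_β'^E = a (h_β/h_β')^(E-m)`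
  have key : ∀ β j β', (c β j : K) * h β ^ E * (h β' ^ E)⁻¹ =
      (a β j β' : K) * (h β * (h β')⁻¹) ^ (E - m β j β') := by
    intro β j β'
    rw [hak]
    conv_rhs => rw [mul_assoc, ← pow_add, Nat.add_sub_of_le (hmE β j β'), mul_pow, inv_pow]
    rw [mul_assoc]
  -- flatten the index set
  set ι := Σ β : Fin (N + 1), Fin (n β + 1)
  have hcard : Fintype.card ι = Fintype.card ι - 1 + 1 :=
    (Nat.succ_pred_eq_of_pos (Fintype.card_pos_iff.2 ⟨⟨0, 0⟩⟩)).symm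
  set e : ι ≃ Fin (Fintype.card ι - 1 + 1) := Fintype.equivFinOfCardEq hcard
  obtain ⟨G, hGdef⟩ : ∃ G : Fin (Fintype.card ι - 1 + 1) → K,
      ∀ l, G l = (c (e.symm l).1 (e.symm l).2 : K) * h (e.symm l).1 ^ E := ⟨_, fun _ => rfl⟩
  have hG : ∀ β' l, G l * (h β' ^ E)⁻¹ ∈ Algebra.adjoin k (Set.range fun i => h i * (h β')⁻¹) := by
    intro β' l
    rw [hGdef, key]
    exact mul_mem (a _ _ β').2 (pow_mem (hq _ β') _)
  refine ⟨E, Fintype.card ι - 1, G, hG, fun l => ?_, fun β' => le_antisymm ?_ ?_⟩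
  · rw [hGdef]
    refine mul_ne_zero ?_ (pow_ne_zero _ (hh _))
    simpa using hc0 (e.symm l).1 (e.symm l).2
  · rw [Ideal.span_le]
    rintro _ ⟨l, rfl⟩
    rw [SetLike.mem_coe]
    beta_reduce
    have hx : (⟨G l * (h β' ^ E)⁻¹, hG β' l⟩ :
        ↥(Algebra.adjoin k (Set.range fun i => h i * (h β')⁻¹))) =
          a (e.symm l).1 (e.symm l).2 β' * ⟨h (e.symm l).1 * (h β')⁻¹, hq (e.symm l).1 β'⟩ ^
            (E - m (e.symm l).1 (e.symm l).2 β') := by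
      apply Subtype.ext
      simp only [MulMemClass.coe_mul, SubmonoidClass.coe_pow]
      rw [hGdef, key]
    rw [hx]
    exact Ideal.mul_mem_right _ _ (haI _ _ _)
  · rw [← hcspan β', Ideal.span_le]
    rintro _ ⟨j, rfl⟩
    refine Ideal.subset_span ⟨e ⟨β', j⟩, Subtype.ext ?_⟩
    show G (e ⟨β', j⟩) * (h β' ^ E)⁻¹ = (c β' j : K)
    rw [hGdef, Equiv.symm_apply_apply, mul_inv_cancel_right₀ (pow_ne_zero _ (hh β'))]

end Summit.ResolutionOfSingularities.ResolutionOfSingularities.Theorems
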